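import Mathlib
import HarnessLib
import HarnessLib.Audit
import Summits.KontsevichZagierPeriods.Statement

/-!
Route: ComplexOrientations

DORMANT since 2026-09-04T22:22:26Z (reconciler: no traction for 5 d (last activity item-evidence-added at 2026-08-30T21:33:33Z); parked, not closed — `ledger route dormant route-KontsevichZagierPeriods-ComplexOrientations --off` to reac) — unstaffed, not closed; items shared with open routes are served there. `ledger route dormant <id> --off` reactivates.

# Route ComplexOrientations — complex orientations integrate — Rokhlin's type decides which
oval-area identities a real curve over Qbar carries, and their chain is Stokes across the half-curve
plus the residue move

It suffices to show X = TypeOneIdentities ∧ OvalSector ∧ CauchyMove ∧ OrientationKernel (card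
complex-orientations-integrate,
realised as an enlarged-kernel route in the shape of AmoebaArea / CobordismMove). The OBJECT is the
oval sector of one smooth
real affine plane curve {p = 0}, p ∈ ℚ[x,y], with compact real locus: the integrand-1
representations over the interiors
R_i of its ovals O_i and the π-carriers [disc of radius √β], β ≥ 0 real algebraic. TypeOneIdentities
(ENGINE, the card's K1):
if the curve is DIVIDING (type I: its non-real complex affine locus is disconnected), every true
unit-sign identity
Σ η_i Area(R_i) = βπ is a chain of KZ moves — its forced instance is Rokhlin's complex orientation
integrated,
(★) Σ η_i Area(R_i) = 2π·|i Σ_{p ∈ S∩H₊} Res_p(x dy)| (support ComplexOrientationIdentity), whose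
chain is Green per cell,
Stokes for Re/Im(x dy) across the half H₊ ⊂ X(ℂ) ⊂ ℝ⁴, and the residue move (support CauchyMove:
Cauchy's theorem for an
algebraic germ on a rational circle is a chain). OvalSector: Conjecture 1 on the whole oval sector
of one curve (all integer
identities, type I or II). OrientationKernel (TARGET, GPC-strength, stated openly): every subgroup R
≥ KZ.relations containing
these relators contains ker KZ.eval. Filed informally after open: OvalRelationsTopological (card K2:
for End(Jac) = ℤ the
ℚ̄-relations among 1, π, Area(R_i) are exactly ℤ·(★) in type I and none in type II — Huber–Wüstholz)
and ToroidalChambers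
(card K3: real quartic surfaces, only torus components can relate).
Lean: `TypeOneIdentities ∧ OvalSector ∧ CauchyMove ∧ OrientationKernel`

## Assembly
Pure logic, proved in the folder's Sketch.lean / glue.lean (rc 0): `closes (h1 : TypeOneIdentities)
(h2 : OvalSector) (h3 : CauchyMove)
(hK : OrientationKernel) : KontsevichZagierPeriods := by intro n m r r' _ _ hv; apply hK
KZ.relations le_rfl h1 h2 h3; simp [KZ.eval_of, hv]`
— the three engines put the relators inside KZ.relations, so the enlarged kernel at R :=
KZ.relations is the kernel form, which gives
the statement pairwise. ComplexOrientationIdentity (values) and the informal items do not enter the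
implication; the honest open core is
OrientationKernel (KZKernelConjecture ⇒ OrientationKernel is an `example` in Sketch.lean).

Rationale: WHY THIS LINE. Real structure generates period identities and Rokhlin tells you which: on a dividing
curve the ovals with their complex
orientations bound the half H₊, so Stokes on H₊ minus pole discs turns ∂H̄₊ = Σ η_i O_i
(Rokhlin1974, Rokhlin1978;
DegtyarevKharlamov2000 §1 'Rokhlin's formula of complex orientations': 2(Π⁺ − Π⁻) = l − k², e.g. the
nested quartic's
injective pair is negative, so (★) reads Area(inner) + Area(outer) = 2π a_X) into one linear
identity among oval AREAS
(Green: ∮_{O_i} x dy = ±Area(R_i)) with right-hand side 2πi·Σ residues of x dy at the places at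
infinity inside H₊ —
algebraic numbers; on a type II curve no signed combination of ovals bounds and, generically,
Huber–Wüstholz
(HuberWustholz2022 Part IV; SertozOuaknineWorrell2025 for effectivity) leave no ℚ̄-relation at all.
The planar-half case is
the founding identity of quadrature domains (Gustafsson1983: quadrature identity ⇔ Schottky double).
Imported: topology of
real algebraic curves (type, complex orientations, Fiedler's pencils to compute η), 1-motivic
transcendence (completeness
side, informal item), classical function theory (residues) — inside KZ's calculus
(KontsevichZagier2001 §1.2) over real
semialgebraic geometry (BochnakCosteRoy1998: components and halves are ℚ-semialgebraic). No prior
route reads the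
anti-holomorphic involution: SymplecticScissors transfers Huber–Wüstholz relations between arbitrary
planar regions by
symplectic maps, UnfoldedStokes does cut-surface Stokes for BILINEAR relations, AmoebaArea needs
Harnack position and
weight π², CobordismMove's cobordism move has no rule for WHICH cycles bound; SmoothStones (closed
not-a-thesis) treated one
oval at a time. Negatives index (1 entry, KinematicPlaneConvex via K = ∅): every statement here is
checked on empty /
k = 0 / β = 0 data (the empty carrier is a relation, Sketch.lean).

RANKED CRUXES. #0 OrientationKernel (target) — the kernel conjecture of the calculus enlarged by
this route's relators: every subgroup R of KZ.FormalRep with KZ.relations ≤ R that contains (i) the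
type-I unit-sign oval identities, (ii) all integer oval-sector identities of one smooth compact real
plane curve against a π-carrier, (iii) the Cauchy relators of algebraic germs on rational circles,
contains ker KZ.eval. KZKernelConjecture ⇒ it (Sketch.lean); it ∧ the three engines ⇒ the summit
(closes). DERIVED since the BC2 redirect of 2026-08-17 (crux-strategist, EXEMPT-46 re-exam of the
RESTATED target): OrientationKernel ⇐ KZDimTwo ∧ ReductionToDimensionTwo (assembly
orientationKernel_of_subs : KZDimTwo → ReductionToDimensionTwo → OrientationKernel, pure logic,
kernel-checked in the strategist's Sketch.lean, Theorems-shaped file attached on stmt-11367;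
ReductionToDimensionTwo is NECESSARY — OrientationKernel → it by the landed
reductionToDimensionOne_of_orientationKernel + reductionToDimensionTwo_of_reductionToDimensionOne —,
both pieces are consequences of the summit and neither gives the summit or the target by any cheap
probe). The earlier cut OrientationKernel ⇐ ReductionToDimensionOne ∧ PlanarAreas (line birth,
landed orientationKernel_of_reductionToDimensionOne_of_planarAreas) does not qualify: PlanarAreas
(stmt-4990) is proved modulo the cite-only Huber–Wüstholz fact
(planarAreas_of_huberWustholzCurvePeriods), so ReductionToDimensionOne (stmt-14403) is ≡ the summit
modulo a published theorem (landed conditional iffs; summit_equivalent flag). (why it might fail: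
GPC-strength: it is the period conjecture modulo this route's relators; false iff some vanishing
combination stays underivable even with the oval-sector and Cauchy relators adjoined (route Neg's
pressure points are untouched by them).) [KontsevichZagier2001, HuberMullerStach2017,
HuberWustholz2022]
#2 TypeOneIdentities (crux) — ENGINE (card K1). For p ∈ ℚ[x,y] with compact real zero locus Z,
smooth complex affine curve, geometrically irreducible, and DIVIDING (the non-real complex affine
locus {p = 0, some Im ≠ 0} is not preconnected): list the ovals O_i (connected components of Z) with
integrand-1 representations s_i over their interiors R_i (the bounded complementary component of
O_i); then for every unit sign vector η ∈ {±1}^k, every real algebraic β ≥ 0 and every integrand-1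
representation e over the disc {x² + y² < β} with Σ η_i·Area(R_i) = Area(e), the combination Σ
η_i[s_i] − [e] lies in KZ.relations. Forced instance: Rokhlin's complex orientation (★); foreseen
chain: Green per CAD cell of each R_i (boundary 1-dim reps over Nash charts of O_i), Stokes for the
closed semialgebraic 1-forms Re/Im(x dy)|_X over the ℚ-semialgebraic bordered surface H̄₊ minus pole
discs ⊂ ℝ⁴ cut into bands (primitives = coordinate functions), CauchyMove at each pole of x dy in
H₊, disc bookkeeping for the 2π-carriers. [deps: CauchyMove] [difficulty: XL] (why it might fail:
The chain must realise Stokes for Re/Im(x dy) across the punctured non-product semialgebraic 2-chain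
H+ in R^4 (bands + primitives integrable at order-3 poles), the open engine shared with
UnfoldedStokes/CobordismMove; a symmetric or CM type-I curve may add a non-homological unit
identity.) [Rokhlin1974, Rokhlin1978, DegtyarevKharlamov2000, KontsevichZagier2001,
BochnakCosteRoy1998, Gustafsson1983]
#3 OvalSector (crux) — Conjecture 1 on the whole oval sector of ONE curve (card 'complete per-curve
answer'): for p ∈ ℚ[x,y] with compact smooth real zero locus (no complex hypotheses), ovals O_i with
interior representations s_i as above, every integer vector n ∈ ℤ^k, real algebraic β ≥ 0 and disc
representation e with Σ n_i·Area(R_i) = Area(e): Σ n_i[s_i] − [e] ∈ KZ.relations. Type I curves: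
ℤ·(★) (TypeOneIdentities + disc scaling); type II generic: vacuous (OvalRelationsTopological);
symmetric curves: rule 2 along the symmetry; CM / split Jacobians: correspondence chains (routes
IsogenyCertificates / MultivaluedCoV). [deps: TypeOneIdentities] [difficulty: XL] (why it might
fail: Contains every correspondence/isogeny-induced identity among oval areas of one curve (CM
Jacobians, type II, any multiplicities), not only the homological one; a single true combination
with no real move chain refutes it together with the summit.) [KontsevichZagier2001,
HuberWustholz2022, Masser2026, SertozOuaknineWorrell2025, Rokhlin1978]
#6 KZDimTwo (crux) — PIECE 1 of the BC2 redirect of the target: Conjecture 1 on the STRATUM of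
KZ-rational representations of dimensions ≤ 2 (for n, m ≤ 2, KZ-rational r, r′ of equal value are
KZ-equivalent). SHARED item stmt-4280 (BianchiHumbert target; HodgeLevel crux 2; DessinsDimensionOne
crux 6; AbelContraction crux 6). It contains this route's whole old layer — KZDimTwo → PlanarAreas →
OvalSector → TypeOneIdentities (landed planarAreas_of_kzDimTwo, ovalSector_of_planarAreas,
typeOneIdentities_of_planarAreas) — and exactly one OPEN layer more (ζ(2) ∈ ℚπ² is landed as a
chain, CompiledSubstitutions' ZetaEvenBKC k = 1; Legendre's relation as planar areas, five-term /
Clausen identities at algebraic points, L(2,χ) are open; no Huber–Wüstholz theorem exists for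
2-periods, so unlike PlanarAreas it is open in substance). Plan: registered skeleton
Cruxes/ExcursionBudget/Lines/bounded_solids.lean (stub_solids, stub_mergeSolids LANDED p148539 /
p148371; open residue stub_solidVolumes = Hilbert III for bounded ℚ-semialgebraic solids in ℝ³
inside the calculus) and the live routes above. [difficulty: XL] (why it might fail: completeness
needs a transcendence theory of 2-periods nobody has (dilog/Clausen values at algebraic points,
ζ(2)·ℚ̄, L(2,χ), Legendre as areas); one additive invariant separating an equal-valued KZ-rational
pair of dimension ≤ 2 refutes it and the summit.) [KontsevichZagier2001, HuberWustholz2022,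
Milnor1982, Zagier1986]
#8 ReductionToDimensionTwo (crux) — PIECE 2 of the BC2 redirect (GPC-strength MODULO the open
stratum KZDimTwo, stated openly, ranked last): every subgroup R ≥ KZ.relations of KZ.FormalRep that
contains [r] − [r′] for every equal-valued pair of KZ-rational representations of dimensions ≤ 2
contains ker KZ.eval — ker eval is generated by the move relators together with the coincidences of
the dimension-two stratum. Item stmt-18030 (AbelContraction crux 8: the same redirect of its target
RealArcKernel, assembly realArcKernel_of_subs landed p148174). NECESSARY for OrientationKernel and
with KZDimTwo SUFFICIENT (orientationKernel_of_subs); the summit implies it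
(reductionToDimensionTwo_of_kontsevichZagierPeriods); it is ≡ the summit / the target only modulo
the OPEN KZDimTwo; special case proved: it holds on the part of ker eval generated by
representations of dimensions ≤ 1 (reductionToDimensionTwo_on_dimLEOne). To be attacked only by
peeling further layers (Cruxes/RealArcKernel/Lines/reddim2_ladder.lean: stub_dimThreeLayerModTwo —
the weight-3 coincidences modulo the stratum — and stub_reductionToDimensionThree), never head-on.
[deps: KZDimTwo] [difficulty: open-problem] (why it might fail: GPC-strength modulo the OPEN stratum
KZDimTwo: false iff a value-0 combination of inputs beyond the stratum (ζ(3)/MZV, Γ-products,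
elliptic quasi-period products — route Neg's bets) is underivable even with every stratum-2
coincidence adjoined; the strength barriers bite here.) [KontsevichZagier2001, HuberMullerStach2017,
Ayoub2015, Fresan2024]
#9 CauchyMove (support) — the residue move's analytic half (card P2): for 0 < ρ < R with ρ real
algebraic and g holomorphic on the ball of radius R and algebraic over ℚ(t) (P(t, g(t)) = 0, P ∈
ℚ[t,u] nonzero), the 1-dimensional representation over ℝ with integrand s ↦ Re(g(γ(s))·γ′(s)), γ(s)
= ρ(1 + is)/(1 − is) the rational parametrisation of the circle |t| = ρ, lies in KZ.relations (value
Re ∮ g dt = 0). Chain: Green on the ℚ-semialgebraic disc with the semialgebraic primitives Re g, Im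
g themselves along u and v (coordinate swap = rule 2), Cauchy–Riemann makes the 2-dim integrand
vanish identically (rule 1b), boundary arcs re-parametrised by s (rule 2 in dimension 1), s > 0 / s
< 0 glued by 1a. With c/t + g in place of g the principal part is the same integrand as the explicit
2π-carrier (−2 Im c)/(1 + s²), so this is all the residue theorem needs inside the rules.
[difficulty: M] [KontsevichZagier2001, BochnakCosteRoy1998]
#9 ComplexOrientationIdentity (support) — VALUES (card P3, Rokhlin's complex orientations
integrated): under the hypotheses of TypeOneIdentities there exist unit signs η, a real algebraic β
≥ 0 with Σ η_i·Area(R_i) = β·π (η = the complex orientations relative to the planar one, β = 2|i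
Σ_{S∩H₊} Res(x dy)|: Stokes on H₊ minus pole discs on the normalisation of the projective closure; k
= 0 gives β = 0). The cheapest numerical test of the whole line (certified areas vs residues at
infinity). [difficulty: L] [Rokhlin1974, DegtyarevKharlamov2000, Gustafsson1983]
#9 OrientationKernelOfSubs (support) — the ASSEMBLY of the BC2 redirect as an item, provable now
(strategist's Sketch.lean / attached Theorems-shaped ComplexOrientationsOrientationKernelSplit.lean,
rc 0, 0 sorry, std axioms; term `fun h₂ hRed R hR _ _ _ x hx => hRed R hR (fun _ _ hn hm r r' hr hr'
hv => hR (h₂ hn hm r r' hr hr' hv)) x hx`): KZDimTwo → ReductionToDimensionTwo → OrientationKernel.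
Given an admissible R ≥ KZ.relations, the stratum puts every equal-valued KZ-rational pair of
dimensions ≤ 2 inside KZ.relations ≤ R and the reduction puts ker KZ.eval inside R; the oval /
Cauchy relator hypotheses are carried, not consumed. Filed as an item (precedents: KernelFormGlue
here, AbelContraction's DimensionOneGlue) so that any idle prover can close it and the final-cycle /
tenure seat can record `--split OrientationKernel --into KZDimTwo ReductionToDimensionTwo --glue-by
<its closing theorem>`; `closes` unchanged. [deps: KZDimTwo, ReductionToDimensionTwo,
OrientationKernel] [difficulty: provable-now] [KontsevichZagier2001, HuberMullerStach2017]
#9 KernelFormGlue (support) — glue to the rank-0 target, provable now (folder Sketch.lean rc 0: `fun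
hK R hR _ _ _ x hx => hR (hK x hx)`): the plain kernel form of the summit — every formal
ℤ-combination of integral representations with value 0 lies in KZ.relations (inlined, never the
Literature constant KZKernelConjecture, so no conjecture leaf enters the cone; summit-equivalent by
kzKernelConjecture_iff_isRational / Theorems/KernelFormKernelImpliesStatement.lean) — implies the
enlarged-kernel target OrientationKernel by monotonicity (x ∈ KZ.relations ≤ R for every admissible
R); conversely OrientationKernel → TypeOneIdentities → OvalSector → CauchyMove → kernel form is the
deciding theorem `closes` read in kernel form (also in Sketch.lean). It records the target's logical
position formally (sandwiched between Conjecture 1 and 'the three engines ⇒ Conjecture 1': modulo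
the engines the target IS Conjecture 1, as its docstring says) and gives the rank-0 target an item
that concludes it (gate shape route.target-unreachable; route-choice 2026-08-16, precedent
IsogenyCertificates' KernelFormGlue). No mathematical risk; `closes` unchanged. [deps:
OrientationKernel] [difficulty: provable-now] [KontsevichZagier2001, HuberMullerStach2017]

TWO-LAYER PLAN. Foreseen glued splits (none filed now): TypeOneIdentities ⇐ GreenToBoundary (Σ
η_i[s_i] ~ signed 1-dim boundary reps over Nash charts of
the ovals; SmoothStones' GreenBridge sharpened) → HalfCurveStokes (Stokes for Re/Im(x dy) on H̄₊
minus pole discs as a chain: CAD of the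
ℚ-semialgebraic surface H₊ ⊂ ℝ⁴ into graph-like bands, band Newton–Leibniz with the coordinate
primitives, cancellation of interior
edges in FormalRep — the instance of UnfoldedStokes' / CobordismMove's engine this route needs) →
TypeOneIdentities (with CauchyMove and
disc bookkeeping m·[disc β] ~ [disc mβ] as prover-level supports). OvalSector ⇐
OvalRelationsTopological (typed once `IsDividing` /
Jacobian genericity are available) → TypeOneIdentities → OvalSector for generic curves; the
symmetric / CM remainder inherits
IsogenyCertificates' chains. Calibration ladder for provers (`--supports TypeOneIdentities`): circle
and ellipse (k = 1, genus 0: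
one rule-2 map); Vieta pair (x²+y²−1)(x²+y²−4)+ε, ε ∈ ℚ small: [R_in] + [R_out] ~ [disc √5] by one
annulus-to-disc map
(x,y) ↦ (x,y)·√(1 − r₂²/(x²+y²)); first genuinely curved instance: a nested (hyperbolic) quartic
with a cubic perturbation, a_X from
the residues of x dy at its four places at infinity. BC2 REDIRECT 2026-08-17 (crux-strategist
cstrat-11367, EXEMPT-46 re-exam of the RESTATED target): OrientationKernel ⇐ KZDimTwo ∧
ReductionToDimensionTwo (assembly orientationKernel_of_subs, trivial seam, kernel-checked; piece
probes → summit / → target fail 20/20; plans: bounded_solids on stmt-4280, reddim2_ladder on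
stmt-18030; new line Cruxes/OrientationKernel/Lines/dimtwo_redirect.lean on the target itself), i.e.
the input-dimension filtration one OPEN layer above the 1-period layer: oval sector ⊂ PlanarAreas ⊂
KZDimTwo ⊂ all inputs; the formal `--split OrientationKernel --into KZDimTwo ReductionToDimensionTwo
--glue-by orientationKernel_of_subs` is recorded as soon as a prover lands
Theorems/ComplexOrientationsOrientationKernelSplit.lean (attached on stmt-11367). The route's own
content is unchanged and sits INSIDE piece 1: the engines TypeOneIdentities / OvalSector are the
oval-sector instances of KZDimTwo that this line claims to realise by Stokes across the half-curve
(they stay binders of `closes`).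

KILL CRITERIA. A dividing curve over ℚ with a TRUE unit-sign oval identity against ℚ̄π that is
provably not a chain refutes TypeOneIdentities — and,
being an instance of Conjecture 1 (difference of volumes), the SUMMIT: close
`refuted:TypeOneIdentities` and hand the witness to route
Neg. A refutation of OvalSector by a correspondence identity on a CM / type II curve that leaves
TypeOneIdentities intact: `--drop
OvalSector` is NOT allowed (it would also refute the summit) — instead the route closes refuted and
the witness goes to Neg. A numerical
failure of ComplexOrientationIdentity on any dividing curve (areas vs 2π·residues to 30 digits)
means the typed hypotheses mis-state
'dividing' or the interiors: restate (misstated), not a kill. PlanarAreas (stmt-4990,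
SymplecticScissors / HodgeLevel / LowDimension)
proved ⇒ TypeOneIdentities and OvalSector follow (both are planar integrand-1 identities after
disjoint translation): go dormant.
CauchyMove refuted ⇒ mis-typed side condition (parametrisation / algebraicity of g): restate.
KZDimTwo refuted (an equal-valued KZ-rational pair of dimensions ≤ 2 provably not KZ-equivalent) or
ReductionToDimensionTwo refuted = the SUMMIT refuted (both are implied by it:
kzDimTwo_of_kontsevichZagierPeriods, reductionToDimensionTwo_of_kontsevichZagierPeriods): hand the
witness to route Neg and close; neither can be dropped while OrientationKernel is derived from them.

NOT DECOMPOSED YET. The two pieces of the redirect are themselves attacked only through their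
registered skeletons (stub_solidVolumes for KZDimTwo; the rung-3 stubs of reddim2_ladder for
ReductionToDimensionTwo) — no third layer is filed here; ReductionToDimensionOne (stmt-14403) and
PlanarAreas (stmt-4990) are NOT items of this route (the former is ≡ the summit modulo
Huber–Wüstholz, the latter is support elsewhere). Still undivided: The half-curve Stokes engine
(HalfCurveStokes) and the Green step — layer-2 children once a prover reports where the band
decomposition
of H₊ ⊂ ℝ⁴ strains; the typed form of OvalRelationsTopological (needs `IsDividing`, complex
orientations and a genericity predicate
End(Jac X_ℂ) = ℤ — definition requests) and of ToroidalChambers (needs H₂ of a real quartic surface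
/ Nikulin invariants); the sign
vector η as Rokhlin's complex orientation (the typed engine quantifies over all unit η with a true
value identity instead); residues
a_X as explicit algebraic numbers per curve (prover-level calibrations); odd-degree and
singular-at-infinity curves (excluded by
compactness / handled on the normalisation in the values support only).

CHEAPEST FALSIFIER. Numerics on one nested quartic (the card's toy F = (x²+y²−1)(x²+2y²−6) +
(1/5)(x³+x²y+y+1/3), kit job j001854 of the ideate seat,
result not readable here): Area(inner) + Area(outer) must equal 2πi(Res_p + Res_q)(x dy) for one of
the four conjugate-transversal
choices of poles at infinity, to 30 digits; and for a two-oval NON-nested quartic without symmetry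
(type II) PSLQ on
(1, π, Area₁, Area₂) must find nothing. Either failure retires ComplexOrientationIdentity's reading
of (★) (misstatement) or the
pruning claim of OvalRelationsTopological. By hand (done): circle — x = (t+1/t)/2, y = (t−1/t)/(2i),
Res(x dy) = −i/2,
2πi·Res = π = Area ✓; Vieta pair (x²+y²−1)(x²+y²−4)+ε — r₁² + r₂² = 5, Area₁ + Area₂ = 5π
independent of ε while Area₂ − Area₁ is
not, matching the negative injective pair of Rokhlin's formula (l = 2, k = 2: Π⁺ − Π⁻ = −1) ✓;
degenerate data k = 0, β = 0,
e.domain = ∅: the empty carrier is a relation (Sketch.lean example) ✓.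

NUMBERS. Rokhlin's formula 2(Π⁺ − Π⁻) = l − k² for nonsingular dividing plane curves of degree 2k
with l ovals (DegtyarevKharlamov2000 §1;
Rokhlin1974); dividing ⇒ l ≥ k and l ≡ k (mod 2) (Klein); quartics: dividing iff M-quartic (l = 4)
or nested pair. Circle: Area = π =
2πi·(−i/2). Items at open: 6 (1 target, 2 cruxes, 2 supports, 1 assembly); after open: +2 informal
cruxes (OvalRelationsTopological
rank 4, ToroidalChambers rank 5) and 1 definition request = 8 items ≤ 15. Rev 1 (route-choice
2026-08-16): +1 support (KernelFormGlue, the glue concluding the target) = 9 items ≤ 15 (1 target, 4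
cruxes of which 2 informal, 3 supports, 1 assembly). Rev 2 (BC2 redirect 2026-08-17): +2 cruxes
(KZDimTwo rank 6 → shared stmt-4280, ReductionToDimensionTwo rank 8 → stmt-18030) = 11 items ≤ 15;
cruxes 7 = cap (OrientationKernel auto-crux, TypeOneIdentities, OvalSector,
OvalRelationsTopological, ToroidalChambers, KZDimTwo, ReductionToDimensionTwo). BC2 probes: 20/20
cheap-tactic attempts fail (pieces → summit, pieces → target); dedup `exact?` fails 2/2;
summit_equivalent flags on 4280 / 18030: none. Rev 4: +1 support (OrientationKernelOfSubs, the
redirect's assembly as a provable-now item) = 12 items ≤ 15, cruxes 7.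

DEFINITION REQUESTS. `IsDividing` / complex orientation of a smooth real plane curve (H₊ := a
connected component of the non-real locus, a ℚ-semialgebraic
subset of ℝ⁴; the induced boundary orientation on each oval) — topic
Literature/AlgebraicGeometry/RealAlgebraic — needed to TYPE
OvalRelationsTopological with Rokhlin's signs and to state HalfCurveStokes; a genericity predicate
`End(Jac X_ℂ) = ℤ` for plane curves
(topic Literature/NumberTheory/Transcendental, next to CurvePeriods) for the Huber–Wüstholz
completeness item. The typed items at open
need neither (type I is inlined as `¬ IsPreconnected {non-real affine locus}`, signs are
quantified).

Novelty: Searches (2026-08-15): `lit search --hybrid "complex orientations dividing real algebraic curve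
areas of ovals residues period identity"`
(12 rows, vector leg only: Arnold–Gusein-Zade–Varchenko, Itenberg–Mikhalkin–Shustin tropical, noise
— nothing on oval areas as periods);
`lit search "Rokhlin complex orientations real algebraic curves dividing type I" --source all`
(searchd rc 75 this hour);
`lit galaxy search "complex orientations" --star all` (33 rows: noise + Khesin–Rosly 'Polar
homology' math/0009015 — residues as boundary
maps, no real structure); `lit galaxy search --star panama --title-contains "real algebraic"
"dividing"` (7 books: AMS Transl. 173
Rokhlin volume, Arnold 'Real Algebraic Geometry', BasuPollackRoy2006, Coste–Mahé–Roy 1991 …, none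
indexing oval areas);
`lit read arxiv:math/0004134 --grep 'complex orientation|dividing'` (76 hits; §1 definition of type
I and Rokhlin's formula used above);
`lit frontier KontsevichZagierPeriods --since 2020` (30 rows, all MZV / motivic Galois side) and
`lit bridges --cross any` (no
real-algebraic-topology paper joins the KZ roots); the 77 Theses files of the sub scanned by title
(no dividing-curve / complex-orientation
route; SmoothStones' BoundingStonePairs — closed — was the one-oval case).
Nearest prior art found: Gustafsson1983 (doi:10.1007/bf00046600: (★) when H₊ is planar = quadrature
identity); Rokhlin1974
(doi:10.1007/bf01075491: the homology relation and orientation formula, no periods);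
HuberWustholz2022 (all ℚ̄-l  [refs: 10.1007/bf00046600:, 10.1007/bf01075491:, math/0004134, arxiv:math/0004134, doi:10.1007/bf00046600, doi:10.1007/bf01075491, BasuPollackRoy2006, Gustafsson1983, Rokhlin1974, HuberWustholz2022]

Barriers (technique_class: real-algebraic-topology, complex-orientation-stokes): - technique_class: real-algebraic-topology, complex-orientation-stokes
- Literature.Barriers.KontsevichZagierPeriods.noSemialgebraicPrimitive_inv_sub_two: evaded — no
variable is integrated out with a transcendental primitive: the chain is Stokes for CLOSED algebraic
1-forms across an algebraic surface (primitives are the coordinate functions on bands of H₊) plus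
CauchyMove, whose 2π is CARRIED by ∫ 2 ds/(1+s²), never divided out; Green uses the primitive y.
- Literature.Barriers.KontsevichZagierPeriods.kzConjecture_implies_ellipticPeriods_algIndep: bites
the target OrientationKernel only (GPC-strength, stated openly); the cruxes claim chains for TRUE
identities and the informal completeness item claims only ℚ̄-LINEAR relations of 1-periods — the
Huber–Wüstholz sector listed in the barrier's evasions_known.
- Literature.Barriers.KontsevichZagierPeriods.kzConjecture_implies_twoPiI_log_algIndep: same —
target only; no logarithm enters the oval sector (compact smooth boundaries: closed paths, no
weight-0 part).
- Literature.Barriers.KontsevichZagierPeriods.kzConjecture_implies_oddZetaAlgIndep: same — target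
only; weight ≥ 3 values never occur among oval areas (1-periods and π).
- Literature.Barriers.KontsevichZagierPeriods.cressonViuSos_prop_3_2: not engaged — no single global
transport map is posited; cells, bands and boundary charts throughout, dissection kept.
- Literature.Barriers.KontsevichZagierPeriods.not_complete_of_undecidable: consistent and locally
discharged — on the

Novelty grade: new-combination — ROUTE-REVIEW grade (refuter-rreview-0815T17-0-0, 2026-08-15; searchd rc75 twice this hour, graded on the planner's documented searches + galaxy bm25 'quadrature domain real algebraic curve dividing' (quadrature-domain literature: Gustafsson, Putinar–Mineev–Teodorescu, Mukherjee — identities for PLAN (refuter refuter-rreview-0815T17-0-0, 2026-08-15T18:10:35Z; prior: doi:10.1007/bf00046600 (Gustafsson 1983: quadrature identities ⇔ Schottky double; the planar-half case of (★)), Aharonov–Shapiro 1976 (domains with quadrature identities; algebraic boundary), doi:10.1007/bf01075491 (Rokhlin 1974: complex orientations, dividing curves, 2(Π⁺−Π⁻)=l−k²), arxiv:math/0004134 (Degtyarev–Kharlamov 2000 §1: type I / complex orientations), HuberWustholz2022 Part IV (all ℚ̄-)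

History (route lifecycle, newest last):
- 2026-08-16T02:19:04Z · AUTO-CRUX: 3 conjecture-grade item(s) promoted to crux (OrientationKernel, OvalRelationsTopological, ToroidalChambers) — refuter vetting / tiering apply (operator:999:1362873)
- 2026-08-16T04:08:00Z · AUTO-CRUX (backfill): OrientationKernel — hypotheses of the deciding theorem that nothing in the route derives are cruxes (operator:999:1085951)
- 2026-08-23T22:53:18Z · DORMANT — reconciler: no traction for 6.3 d (last activity item-evidence-added at 2026-08-17T14:47:04Z); parked, not closed — `ledger route dormant route-KontsevichZagier (operator:999:218905)
- 2026-08-30T02:49:28Z · REACTIVATED — reconciler: reactivated — activity statement-attached at 2026-08-30T02:02:28Z after parking at 2026-08-23T22:53:18Z (operator:999:1147533)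
- 2026-09-04T22:22:26Z · DORMANT — reconciler: no traction for 5 d (last activity item-evidence-added at 2026-08-30T21:33:33Z); parked, not closed — `ledger route dormant route-KontsevichZagierPe (operator:999:951898)

sub-problem: KontsevichZagierPeriods · status: dormant · opened planner-plancard-KontsevichZagierPeriods-Kont-e50d8e0e-0 2026-08-15T17:27:07Z · rev 4 · ledger route-KontsevichZagierPeriods-ComplexOrientations
GENERATED by the gate from the ledger (D-0016/17). Provers cite these decls: `theorem foo : Summit.KontsevichZagierPeriods.KontsevichZagierPeriods.Theses.ComplexOrientations.<Decl> := …` in Summits/KontsevichZagierPeriods/KontsevichZagierPeriods/Theorems/<Name>.lean.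
-/

namespace Summit.KontsevichZagierPeriods.KontsevichZagierPeriods.Theses.ComplexOrientations

open scoped BigOperators Topology Manifold Classical MeasureTheory ProbabilityTheory Matrix InnerProductSpace ComplexConjugate ContinuousMap
open Filter Set Function TopologicalSpace MeasureTheory

attribute [summit_statement] _root_.KontsevichZagierPeriods

open Literature Periods

/-- item stmt-KontsevichZagierPeriods-11367 · crux (kind.auto-crux: conjecture-grade) · rank 0 · open · by planner
why it might fail: GPC-strength: it is the period conjecture modulo this route's relators; false iff some vanishing combination stays underivable even with the oval-sector and Cauchy relators adjoined (route Neg's pressure points are untouched by them).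
sources: KontsevichZagier2001, HuberMullerStach2017, HuberWustholz2022
[target] the kernel conjecture of the calculus enlarged by this route's relators: every subgroup R
of KZ.FormalRep with KZ.relations ≤ R that contains (i) the type-I unit-sign oval identities, (ii)
all integer oval-sector identities of one smooth compact real plane curve against a π-carrier, (iii)
the Cauchy relators of algebraic germs on rational circles, contains ker KZ.eval. KZKernelConjecture
⇒ it (Sketch.lean); it ∧ the three engines ⇒ the summit (closes). -/
@[route_item "route-KontsevichZagierPeriods-ComplexOrientations"]
def OrientationKernel : Prop :=
  ∀ R : AddSubgroup Literature.NumberTheory.Transcendental.KZ.FormalRep, Literature.NumberTheory.Transcendental.KZ.relations ≤ R → (∀ (p : MvPolynomial (Fin 2) ℚ), IsCompact {v : Fin 2 → ℝ | MvPolynomial.aeval v p = 0} → (∀ w : Fin 2 → ℂ, MvPolynomial.aeval w p = 0 → ∃ i, MvPolynomial.aeval w (MvPolynomial.pderiv i p) ≠ 0) → Irreducible (MvPolynomial.map (algebraMap ℚ ℂ) p) → ¬ IsPreconnected {w : Fin 2 → ℂ | MvPolynomial.aeval w p = 0 ∧ ∃ i, (w i).im ≠ 0} → ∀ (k : ℕ)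 (O : Fin k → Set (Fin 2 → ℝ)) (s : Fin k → Literature.NumberTheory.Transcendental.KZ.IntegralRep 2), (∀ i, ∃ v : Fin 2 → ℝ, MvPolynomial.aeval v p = 0 ∧ O i = connectedComponentIn {u : Fin 2 → ℝ | MvPolynomial.aeval u p = 0} v) → Function.Injective O → (∀ v : Fin 2 → ℝ, MvPolynomial.aeval v p = 0 → ∃ i, v ∈ O i) → (∀ i, (s i).domain = {v : Fin 2 → ℝ | v ∉ O i ∧ Bornology.IsBounded (connectedComponentIn (O i)ᶜ v)}) → (∀ i, ∀ v ∈ (s i).domain, (s i).integrand v = 1) → ∀ (η : Fin k → ℤ) (β : ℝ) (e : Literature.NumberTheory.Transcendental.KZ.IntegralRep 2), (∀ i, η i = 1 ∨ η i = -1) → IsAlgebraic ℚ β → 0 ≤ β → e.domain = {v : Fin 2 → ℝ | v 0 ^ 2 + v 1 ^ 2 < β} → (∀ v ∈ e.domain, e.integrand v = 1) → ∑ i, (η i : ℝ) * (s i).value = e.value → (∑ i, η i • Literature.NumberTheory.Transcendental.KZ.of (s i)) - Literature.NumberTheory.Transcendental.KZ.of e ∈ R) → (∀ (p : MvPolynomial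 (Fin 2) ℚ), IsCompact {v : Fin 2 → ℝ | MvPolynomial.aeval v p = 0} → (∀ v : Fin 2 → ℝ, MvPolynomial.aeval v p = 0 → ∃ i, MvPolynomial.aeval v (MvPolynomial.pderiv i p) ≠ 0) → ∀ (k : ℕ) (O : Fin k → Set (Fin 2 → ℝ)) (s : Fin k → Literature.NumberTheory.Transcendental.KZ.IntegralRep 2), (∀ i, ∃ v : Fin 2 → ℝ, MvPolynomial.aeval v p = 0 ∧ O i = connectedComponentIn {u : Fin 2 → ℝ | MvPolynomial.aeval u p = 0} v) → Function.Injective O → (∀ v : Fin 2 → ℝ, MvPolynomial.aeval v p = 0 → ∃ i, v ∈ O i) → (∀ i, (s i).domain = {v : Fin 2 → ℝ | v ∉ O i ∧ Bornology.IsBounded (connectedComponentIn (O i)ᶜ v)}) → (∀ i, ∀ v ∈ (s i).domain, (s i).integrand v = 1) → ∀ (n : Fin k → ℤ) (β : ℝ) (e : Literature.NumberTheory.Transcendental.KZ.IntegralRep 2), IsAlgebraic ℚ β → 0 ≤ β → e.domain = {v : Fin 2 → ℝ | v 0 ^ 2 + v 1 ^ 2 < β} → (∀ v ∈ e.domain,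 e.integrand v = 1) → ∑ i, (n i : ℝ) * (s i).value = e.value → (∑ i, n i • Literature.NumberTheory.Transcendental.KZ.of (s i)) - Literature.NumberTheory.Transcendental.KZ.of e ∈ R) → (∀ (ρ R' : ℝ) (g : ℂ → ℂ), 0 < ρ → ρ < R' → IsAlgebraic ℚ ρ → DifferentiableOn ℂ g (Metric.ball 0 R') → (∃ P : MvPolynomial (Fin 2) ℚ, P ≠ 0 ∧ ∀ t ∈ Metric.ball (0 : ℂ) R', MvPolynomial.aeval ![t, g t] P = 0) → ∀ r : Literature.NumberTheory.Transcendental.KZ.IntegralRep 1, r.domain = Set.univ → (∀ z : Fin 1 → ℝ, r.integrand z = (g ((ρ : ℂ) * (1 + (z 0 : ℂ) * Complex.I) / (1 - (z 0 : ℂ) * Complex.I)) * ((ρ : ℂ) * (2 * Complex.I) / (1 - (z 0 : ℂ) * Complex.I) ^ 2)).re) → Literature.NumberTheory.Transcendental.KZ.of r ∈ R) → ∀ x : Literature.NumberTheory.Transcendental.KZ.FormalRep, Literature.NumberTheory.Transcendental.KZ.eval x = 0 → x ∈ R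

/-- item stmt-KontsevichZagierPeriods-11368 · crux · rank 2 · open · by planner
why it might fail: The chain must realise Stokes for Re/Im(x dy) across the punctured non-product semialgebraic 2-chain H+ in R^4 (bands + primitives integrable at order-3 poles), the open engine shared with UnfoldedStokes/CobordismMove; a symmetric or CM type-I curve may add a non-homological unit identity.
sources: Rokhlin1974, Rokhlin1978, DegtyarevKharlamov2000, KontsevichZagier2001, BochnakCosteRoy1998, Gustafsson1983
[crux] ENGINE (card K1). For p ∈ ℚ[x,y] with compact real zero locus Z, smooth complex affine curve,
geometrically irreducible, and DIVIDING (the non-real complex affine locus {p = 0, some Im ≠ 0} is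
not preconnected): list the ovals O_i (connected components of Z) with integrand-1 representations
s_i over their interiors R_i (the bounded complementary component of O_i); then for every unit sign
vector η ∈ {±1}^k, every real algebraic β ≥ 0 and every integrand-1 representation e over the disc
{x² + y² < β} with Σ η_i·Area(R_i) = Area(e), the combination Σ η_i[s_i] − [e] lies in KZ.relations.
Forced instance: Rokhlin's complex orientation (★); foreseen chain: Green per CAD cell of each R_i
(boundary 1-dim reps over Nash charts of O_i), Stokes for the closed semialgebraic 1-forms Re/Im(x
dy)|_X over the ℚ-semialgebraic bordered surface H̄₊ minus pole discs ⊂ ℝ⁴ cut into bands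
(primitives = coordinate functions), CauchyMove at each pole of x dy in H₊, disc bookkeeping for the
2π-carriers. [deps: CauchyMove] [difficulty: XL] -/
@[route_item "route-KontsevichZagierPeriods-ComplexOrientations"]
def TypeOneIdentities : Prop :=
  ∀ (p : MvPolynomial (Fin 2) ℚ), IsCompact {v : Fin 2 → ℝ | MvPolynomial.aeval v p = 0} → (∀ w : Fin 2 → ℂ, MvPolynomial.aeval w p = 0 → ∃ i, MvPolynomial.aeval w (MvPolynomial.pderiv i p) ≠ 0) → Irreducible (MvPolynomial.map (algebraMap ℚ ℂ) p) → ¬ IsPreconnected {w : Fin 2 → ℂ | MvPolynomial.aeval w p = 0 ∧ ∃ i, (w i).im ≠ 0} → ∀ (k : ℕ) (O : Fin k → Set (Fin 2 → ℝ)) (s : Fin k → Literature.NumberTheory.Transcendental.KZ.IntegralRep 2), (∀ i, ∃ v : Fin 2 → ℝ, MvPolynomial.aeval v p = 0 ∧ O i = connectedComponentIn {u : Fin 2 → ℝ | MvPolynomial.aeval u p = 0} v) → Function.Injective O → (∀ v : Fin 2 → ℝ, MvPolynomial.aeval v p = 0 → ∃ i, v ∈ O i) → (∀ i, (s i).domain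 = {v : Fin 2 → ℝ | v ∉ O i ∧ Bornology.IsBounded (connectedComponentIn (O i)ᶜ v)}) → (∀ i, ∀ v ∈ (s i).domain, (s i).integrand v = 1) → ∀ (η : Fin k → ℤ) (β : ℝ) (e : Literature.NumberTheory.Transcendental.KZ.IntegralRep 2), (∀ i, η i = 1 ∨ η i = -1) → IsAlgebraic ℚ β → 0 ≤ β → e.domain = {v : Fin 2 → ℝ | v 0 ^ 2 + v 1 ^ 2 < β} → (∀ v ∈ e.domain, e.integrand v = 1) → ∑ i, (η i : ℝ) * (s i).value = e.value → (∑ i, η i • Literature.NumberTheory.Transcendental.KZ.of (s i)) - Literature.NumberTheory.Transcendental.KZ.of e ∈ Literature.NumberTheory.Transcendental.KZ.relations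

/-- item stmt-KontsevichZagierPeriods-11369 · crux · rank 3 · open · by planner
why it might fail: Contains every correspondence/isogeny-induced identity among oval areas of one curve (CM Jacobians, type II, any multiplicities), not only the homological one; a single true combination with no real move chain refutes it together with the summit.
sources: KontsevichZagier2001, HuberWustholz2022, Masser2026, SertozOuaknineWorrell2025, Rokhlin1978
[crux] Conjecture 1 on the whole oval sector of ONE curve (card 'complete per-curve answer'): for p
∈ ℚ[x,y] with compact smooth real zero locus (no complex hypotheses), ovals O_i with interior
representations s_i as above, every integer vector n ∈ ℤ^k, real algebraic β ≥ 0 and disc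
representation e with Σ n_i·Area(R_i) = Area(e): Σ n_i[s_i] − [e] ∈ KZ.relations. Type I curves:
ℤ·(★) (TypeOneIdentities + disc scaling); type II generic: vacuous (OvalRelationsTopological);
symmetric curves: rule 2 along the symmetry; CM / split Jacobians: correspondence chains (routes
IsogenyCertificates / MultivaluedCoV). [deps: TypeOneIdentities] [difficulty: XL] -/
@[route_item "route-KontsevichZagierPeriods-ComplexOrientations"]
def OvalSector : Prop :=
  ∀ (p : MvPolynomial (Fin 2) ℚ), IsCompact {v : Fin 2 → ℝ | MvPolynomial.aeval v p = 0} → (∀ v : Fin 2 → ℝ, MvPolynomial.aeval v p = 0 → ∃ i, MvPolynomial.aeval v (MvPolynomial.pderiv i p) ≠ 0) → ∀ (k : ℕ) (O : Fin k → Set (Fin 2 → ℝ)) (s : Fin k → Literature.NumberTheory.Transcendental.KZ.IntegralRep 2), (∀ i, ∃ v : Fin 2 → ℝ, MvPolynomial.aeval v p = 0 ∧ O i = connectedComponentIn {u : Fin 2 → ℝ | MvPolynomial.aeval u p = 0} v) → Function.Injective O → (∀ v : Fin 2 → ℝ, MvPolynomial.aeval v p = 0 → ∃ i, v ∈ O i)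 → (∀ i, (s i).domain = {v : Fin 2 → ℝ | v ∉ O i ∧ Bornology.IsBounded (connectedComponentIn (O i)ᶜ v)}) → (∀ i, ∀ v ∈ (s i).domain, (s i).integrand v = 1) → ∀ (n : Fin k → ℤ) (β : ℝ) (e : Literature.NumberTheory.Transcendental.KZ.IntegralRep 2), IsAlgebraic ℚ β → 0 ≤ β → e.domain = {v : Fin 2 → ℝ | v 0 ^ 2 + v 1 ^ 2 < β} → (∀ v ∈ e.domain, e.integrand v = 1) → ∑ i, (n i : ℝ) * (s i).value = e.value → (∑ i, n i • Literature.NumberTheory.Transcendental.KZ.of (s i)) - Literature.NumberTheory.Transcendental.KZ.of e ∈ Literature.NumberTheory.Transcendental.KZ.relations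

-- item stmt-KontsevichZagierPeriods-11397 · crux (kind.auto-crux: conjecture-grade) · rank 4 · open · by planner — informal only, no Lean statement yet:
--   [crux] OvalRelationsTopological (card K2 — VALUES / completeness side; informal until `IsDividing`,
--   complex-orientation signs and a genericity predicate `End(Jac X̄_ℂ) = ℤ` are typed — definition
--   request filed): for a smooth, geometrically irreducible real affine plane curve X = {p = 0}, p ∈
--   ℚ[x,y], with compact real locus, ovals O_1..O_ℓ with interiors R_i, places at infinity S, and
--   End(Jac X̄_ℂ) = ℤ with S in general position: dim_ℚ̄ ⟨1, π, Area(R_1), …, Area(R_ℓ)⟩ = ℓ + 2 − [X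
--   dividing]; in the dividing case the unique relation is (★) Σ η_i Area(R_i) = 2π·i·Σ_{p ∈ S∩H₊}
--   Res_p(x dy), η = Rok

-- item stmt-KontsevichZagierPeriods-11409 · crux (kind.auto-crux: conjecture-grade) · rank 5 · open · by planner — informal only, no Lean statement yet:
--   [crux] ToroidalChambers (card K3, the mechanism one dimension up; informal until H₂ of a real
--   surface / Nikulin's real-K3 lattice invariants are expressible): (a) [provable on paper now] for a
--   smooth real quartic (K3) surface X ⊂ ℙ³ over ℚ̄∩ℝ with the plane at infinity H∞ transverse and X(ℝ)
--   compact in the affine chart, a relation Σ n_j[Σ_j] = 0 in H₂(X(ℂ); ℚ) among real components forces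
--   n_j = 0 unless Σ_j is a torus (real components are Lagrangian after hyperkähler rotation: [Σ]² =
--   −χ(Σ), disjoint components orthogonal, Gram matrix diag(−χ(Σ_j))) — spheres and higher-genus
--   chambers NEVER sat

/-- item stmt-KontsevichZagierPeriods-4280 · crux · rank 6 · open · by planner
why it might fail: Completeness needs a transcendence theory of 2-periods nobody has (dilog/Clausen values at algebraic points, ζ(2)·ℚ̄, L(2,χ), Legendre as planar areas); one additive invariant separating an equal-valued KZ-rational pair of dimension ≤ 2 refutes it and the summit.
sources: KontsevichZagier2001, HuberWustholz2022, Milnor1982, Zagier1986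
[target] the dimension-two stratum: for n, m ≤ 2, KZ-rational reps r : IntegralRep n, r' :
IntegralRep m with equal value are KZ-equivalent. -/
@[route_item "route-KontsevichZagierPeriods-ComplexOrientations"]
def KZDimTwo : Prop :=
  ∀ ⦃n m : ℕ⦄, n ≤ 2 → m ≤ 2 → ∀ (r : Literature.NumberTheory.Transcendental.KZ.IntegralRep n) (r' : Literature.NumberTheory.Transcendental.KZ.IntegralRep m), r.IsRational → r'.IsRational → r.value = r'.value → Literature.NumberTheory.Transcendental.KZ.Equivalent r r'

/-- item stmt-KontsevichZagierPeriods-18030 · crux · rank 8 · open · by planner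
why it might fail: GPC-strength modulo the OPEN stratum KZDimTwo: false iff a value-0 combination of inputs beyond the stratum (ζ(3)/MZV, Γ-products, elliptic quasi-period products — route Neg's bets) is underivable even with every stratum-2 coincidence adjoined.
sources: KontsevichZagier2001, HuberMullerStach2017, Ayoub2015, Fresan2024
[crux] REDUCTION OF THE SUMMIT TO THE DIMENSION-TWO STRATUM (piece 2 of the BC2 redirect of the
target RealArcKernel; GPC-strength MODULO the open stratum KZDimTwo, stated openly, ranked last):
every subgroup R ≥ KZ.relations of KZ.FormalRep that contains [r] − [r′] for every equal-valued pair
of KZ-rational representations of dimensions ≤ 2 contains ker KZ.eval — ker eval is generated by the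
move relators together with the coincidences of the dimension-two stratum. NECESSARY for the target
(RealArcKernel → it: landed reductionToDimensionOne_of_realArcKernel + the graph-lift monotonicity
`dimOne_pairs_of_dimTwo_pairs`, a 1-dim semialgebraic pair being one Newton–Leibniz move from a
KZ-rational 2-dim pair, KZ.IntegralRep.graphRep) and with KZDimTwo SUFFICIENT (realArcKernel_of_subs
: KZDimTwo → ReductionToDimensionTwo → RealArcKernel, pure logic, kernel-checked, Sketch.lean /
Theorems-shaped AbelContractionRealArcKernelSplit.lean attached on stmt-12472); the summit implies
it; it gives neither the summit nor the target by any cheap probe, and — unlike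
ReductionToDimensionOne, which is ≡ the summit modulo the PUBLISHED Huber–Wüstholz theorem
(planarAreas_of_huberWustholzCurvePeriods -/
@[route_item "route-KontsevichZagierPeriods-ComplexOrientations"]
def ReductionToDimensionTwo : Prop :=
  ∀ R : AddSubgroup Literature.NumberTheory.Transcendental.KZ.FormalRep, Literature.NumberTheory.Transcendental.KZ.relations ≤ R → (∀ ⦃n m : ℕ⦄, n ≤ 2 → m ≤ 2 → ∀ (r : Literature.NumberTheory.Transcendental.KZ.IntegralRep n) (r' : Literature.NumberTheory.Transcendental.KZ.IntegralRep m), r.IsRational → r'.IsRational → r.value = r'.value → Literature.NumberTheory.Transcendental.KZ.of r - Literature.NumberTheory.Transcendental.KZ.of r' ∈ R) → ∀ x : Literature.NumberTheory.Transcendental.KZ.FormalRep, Literature.NumberTheory.Transcendental.KZ.eval x = 0 → x ∈ R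

/-- item stmt-KontsevichZagierPeriods-11370 · support · rank 9 · closed · proved by Summit.KontsevichZagierPeriods.ComplexOrientations.cauchyMove_proof @ 30823284ed40 (prover) · by planner
sources: KontsevichZagier2001, BochnakCosteRoy1998
[support] the residue move's analytic half (card P2): for 0 < ρ < R with ρ real algebraic and g
holomorphic on the ball of radius R and algebraic over ℚ(t) (P(t, g(t)) = 0, P ∈ ℚ[t,u] nonzero),
the 1-dimensional representation over ℝ with integrand s ↦ Re(g(γ(s))·γ′(s)), γ(s) = ρ(1 + is)/(1 −
is) the rational parametrisation of the circle |t| = ρ, lies in KZ.relations (value Re ∮ g dt = 0).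
Chain: Green on the ℚ-semialgebraic disc with the semialgebraic primitives Re g, Im g themselves
along u and v (coordinate swap = rule 2), Cauchy–Riemann makes the 2-dim integrand vanish
identically (rule 1b), boundary arcs re-parametrised by s (rule 2 in dimension 1), s > 0 / s < 0
glued by 1a. With c/t + g in place of g the principal part is the same integrand as the explicit
2π-carrier (−2 Im c)/(1 + s²), so this is all the residue theorem needs inside the rules.
[difficulty: M] -/
@[route_item "route-KontsevichZagierPeriods-ComplexOrientations"]
def CauchyMove : Prop :=
  ∀ (ρ R : ℝ) (g : ℂ → ℂ), 0 < ρ → ρ < R → IsAlgebraic ℚ ρ → DifferentiableOn ℂ g (Metric.ball 0 R) → (∃ P : MvPolynomial (Fin 2) ℚ, P ≠ 0 ∧ ∀ t ∈ Metric.ball (0 : ℂ) R, MvPolynomial.aeval ![t, g t] P = 0) → ∀ r : Literature.NumberTheory.Transcendental.KZ.IntegralRep 1, r.domain = Set.univ → (∀ z : Fin 1 → ℝ, r.integrand z = (g ((ρ : ℂ) * (1 + (z 0 : ℂ) * Complex.I) / (1 - (z 0 : ℂ) * Complex.I)) * ((ρ : ℂ) * (2 * Complex.I) / (1 - (z 0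 : ℂ) * Complex.I) ^ 2)).re) → Literature.NumberTheory.Transcendental.KZ.of r ∈ Literature.NumberTheory.Transcendental.KZ.relations

-- `CauchyMove` holds: proved by `Summit.KontsevichZagierPeriods.ComplexOrientations.cauchyMove_proof` @ 30823284ed40 (its module imports this route file, so no `_holds` link can be stated here).

/-- item stmt-KontsevichZagierPeriods-11371 · support · rank 9 · open · by planner
sources: Rokhlin1974, DegtyarevKharlamov2000, Gustafsson1983
[support] VALUES (card P3, Rokhlin's complex orientations integrated): under the hypotheses of
TypeOneIdentities there exist unit signs η, a real algebraic β ≥ 0 with Σ η_i·Area(R_i) = β·π (η =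
the complex orientations relative to the planar one, β = 2|i Σ_{S∩H₊} Res(x dy)|: Stokes on H₊ minus
pole discs on the normalisation of the projective closure; k = 0 gives β = 0). The cheapest
numerical test of the whole line (certified areas vs residues at infinity). [difficulty: L] -/
@[route_item "route-KontsevichZagierPeriods-ComplexOrientations"]
def ComplexOrientationIdentity : Prop :=
  ∀ (p : MvPolynomial (Fin 2) ℚ), IsCompact {v : Fin 2 → ℝ | MvPolynomial.aeval v p = 0} → (∀ w : Fin 2 → ℂ, MvPolynomial.aeval w p = 0 → ∃ i, MvPolynomial.aeval w (MvPolynomial.pderiv i p) ≠ 0) → Irreducible (MvPolynomial.map (algebraMap ℚ ℂ) p) → ¬ IsPreconnected {w : Fin 2 → ℂ | MvPolynomial.aeval w p = 0 ∧ ∃ i, (w i).im ≠ 0} → ∀ (k : ℕ) (O : Fin k → Set (Fin 2 → ℝ)) (s : Fin k → Literature.NumberTheory.Transcendental.KZ.IntegralRep 2), (∀ i, ∃ v : Fin 2 → ℝ, MvPolynomial.aeval v p = 0 ∧ O i = connectedComponentIn {u : Fin 2 → ℝ | MvPolynomial.aeval u p = 0} v) → Function.Injective O → (∀ v : Fin 2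 → ℝ, MvPolynomial.aeval v p = 0 → ∃ i, v ∈ O i) → (∀ i, (s i).domain = {v : Fin 2 → ℝ | v ∉ O i ∧ Bornology.IsBounded (connectedComponentIn (O i)ᶜ v)}) → (∀ i, ∀ v ∈ (s i).domain, (s i).integrand v = 1) → ∃ (η : Fin k → ℤ) (β : ℝ), (∀ i, η i = 1 ∨ η i = -1) ∧ IsAlgebraic ℚ β ∧ 0 ≤ β ∧ ∑ i, (η i : ℝ) * (s i).value = β * Real.pi

/-- item stmt-KontsevichZagierPeriods-14292 · support · rank 9 · closed · proved by Summit.KontsevichZagierPeriods.ComplexOrientations.KernelFormGlue.KernelFormGlue_proof @ 9bd443587971 (prover) · by planner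
sources: KontsevichZagier2001, HuberMullerStach2017
[support] glue to the rank-0 target (route-choice 2026-08-16, gate shape route.target-unreachable),
provable now (folder Sketch.lean rc 0, axioms standard: `fun hK R hR _ _ _ x hx => hR (hK x hx)`):
the plain kernel form of the summit — every formal ℤ-combination of integral representations with
value 0 lies in KZ.relations (inlined here, never the Literature constant KZKernelConjecture, so no
conjecture leaf enters the route cone; it is summit-equivalent by kzKernelConjecture_iff_isRational,
tree: Literature/NumberTheory/Transcendental/KZKernelConjectureForms.lean and
Theorems/KernelFormKernelImpliesStatement.lean) — implies the enlarged-kernel target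
OrientationKernel, because for every subgroup R with KZ.relations ≤ R (whatever relators it
contains) a combination in ker KZ.eval lies in KZ.relations ≤ R. Filed to make the target's logical
position explicit — Conjecture 1 ⇒ kernel form ⇒ OrientationKernel, and conversely OrientationKernel
∧ TypeOneIdentities ∧ OvalSector ∧ CauchyMove ⇒ kernel form is the deciding theorem `closes` read in
kernel form (also checked in Sketch.lean), so modulo the three engines the target IS Conjecture 1
(GPC-strength, as its docstring says) — and to -/
@[route_item "route-KontsevichZagierPeriods-ComplexOrientations"]
def KernelFormGlue : Prop :=
  (∀ x : Literature.NumberTheory.Transcendental.KZ.FormalRep, Literature.NumberTheory.Transcendental.KZ.eval x = 0 → x ∈ Literature.NumberTheory.Transcendental.KZ.relations) → OrientationKernel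

-- `KernelFormGlue` holds: proved by `Summit.KontsevichZagierPeriods.ComplexOrientations.KernelFormGlue.KernelFormGlue_proof` @ 9bd443587971 (its module imports this route file, so no `_holds` link can be stated here).

/-- item stmt-KontsevichZagierPeriods-18007 · support · rank 9 · open · by planner
sources: KontsevichZagier2001, HuberMullerStach2017
[support] ASSEMBLY of the BC2 redirect of the target (crux-strategist 2026-08-17), provable now:
KZDimTwo → ReductionToDimensionTwo → OrientationKernel — given an admissible R ≥ KZ.relations
(containing the route's oval / Cauchy relators), Conjecture 1 on the dimension-two KZ-rational
stratum puts every equal-valued KZ-rational pair of dimensions ≤ 2 inside KZ.relations ≤ R, and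
ReductionToDimensionTwo then puts ker KZ.eval inside R; the relator hypotheses are carried, not
consumed. Proof term (kernel-checked, strategist Sketch.lean and the attached Theorems-shaped
ComplexOrientationsOrientationKernelSplit.lean, rc 0, 0 sorry, axioms
propext/Classical.choice/Quot.sound): `fun h₂ hRed R hR _ _ _ x hx => hRed R hR (fun _ _ hn hm r r'
hr hr' hv => hR (h₂ hn hm r r' hr hr' hv)) x hx`. Once closed, the final-cycle / tenure seat records
`route edit --split OrientationKernel --into KZDimTwo ReductionToDimensionTwo --glue-by <closing
theorem>` and OrientationKernel becomes DERIVED. Precedents: KernelFormGlue (this route, rev 1),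
AbelContraction's DimensionOneGlue / realArcKernel_of_subs (p148174). [deps: KZDimTwo,
ReductionToDimensionTwo, OrientationKernel] [difficulty: provable-now] -/
@[route_item "route-KontsevichZagierPeriods-ComplexOrientations"]
def OrientationKernelOfSubs : Prop :=
  KZDimTwo → ReductionToDimensionTwo → OrientationKernel

/-- item stmt-KontsevichZagierPeriods-11372 · assembly · rank 1 · closed · proved by Summit.KontsevichZagierPeriods.ComplexOrientations.assembly_proof @ 693c96ac9506 (prover) · by planner
sources: KontsevichZagier2001, HuberMullerStach2017
[assembly] TypeOneIdentities → OvalSector → CauchyMove → OrientationKernel →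
KontsevichZagierPeriods. -/
@[route_item "route-KontsevichZagierPeriods-ComplexOrientations"]
def Assembly : Prop :=
  TypeOneIdentities → OvalSector → CauchyMove → OrientationKernel → KontsevichZagierPeriods

-- `Assembly` holds: proved by `Summit.KontsevichZagierPeriods.ComplexOrientations.assembly_proof` @ 693c96ac9506 (its module imports this route file, so no `_holds` link can be stated here).

/-! D-0027 §2.1 — DECIDING THEOREM (planner-authored via `route open/edit --closes-file`; by planner-plancard-KontsevichZagierPeriods-Kont-e50d8e0e-0 2026-08-15T17:27:09Z):
its hypotheses are this route's items and its conclusion the sub-problem Statement (glue_lint), and it elaborates with this file. -/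

@[closes "route-KontsevichZagierPeriods-ComplexOrientations"] theorem closes (h1 : TypeOneIdentities) (h2 : OvalSector) (h3 : CauchyMove) (hK : OrientationKernel) :
    KontsevichZagierPeriods := by
  intro n m r r' _ _ hv
  apply hK Literature.NumberTheory.Transcendental.KZ.relations le_rfl h1 h2 h3
  simp [Literature.NumberTheory.Transcendental.KZ.eval_of, hv]

end Summit.KontsevichZagierPeriods.KontsevichZagierPeriods.Theses.ComplexOrientations
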